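import Summits.HodgeConjecture.CorCM.Census.DecicWeil23MultiParts
import Summits.HodgeConjecture.CorCM.DecicWeil23PairTwoTransitiveTransfer
import Summits.HodgeConjecture.CorCM.OcticWeilOrbitFrameTransfer
import HarnessLib

/-!
# COR-CM — any number `r` of `(2,3)`-types over one DECIC CM field `K ⊇ k`: `E × B₁ × ⋯ × B_r` — the slots, the model map, FRAME
# TRANSFER under the realised permutations (no Galois hypothesis), and the divisor lines of conjugate pairs

Cell `pub-hodgecm2` (COR-CM), seat b30 gen 24 (2026-08-22); count-neutral own lane DECIC-MULTI, over the kernel census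
`Census/DecicWeil23Multi{,Defect,Parts,Extraction}`.  Theorems, plus TWO bookkeeping definitions (the slot map `multiSlots` and the
model map `toPtM`, the `r`-slot twins of gen 20's `OcticWeilOrbit.orbitSlots` and gen 22's `DecicWeil23Triple.toPtT`); the
realiser lemmas `apply_comp_eq_of_realises` / `comp_eq_tau_iff_of_realises` and the finset `realisedPerms e` are gen 23's
(`CorCM/DecicWeil23PairTwoTransitiveTransfer`) BY NAME; no named fact, no `sorry`.
SETTING: index type `I`, fields `Kf`, `r + 1` slots `multiSlots r i₀ i₁ = (i₀, i₁, …, i₁)` (`Fin.cons`, so that the field of slot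
`m+1` is DEFINITIONALLY `Kf i₁`); realisations `A j ⊨ (Kf (multiSlots r i₀ i₁ j); Φ j)`: `E = A 0 ⊨ (k; {τ})` (`hΨ`),
`B_m = A (m+1) ⊨ (K; Φ_(m+1))` with `s ∈ Φ_(m+1) ⟺ (e s).2 = P m (e s).1` (`hΦ`) for a frame `e : Hom(K,ℂ) ≃ Fin 5 × Bool`.

* §0 `multiSlots`, `toPtM` (`(0, σ) ↦ inl [σ = τ]`, `(m+1, s) ↦ inr (m, e s)`), `sigma_casesM`, `toPtM_injective`, `toPtM_conj_smul`;
* §1 `comp_mem_iff_toPtM_mem_phiM` — for a realiser `ρ` of the permutation `π`, `ρ ∘ x ∈ Φ ⟺ toPtM x ∈ phiM P π`;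
* §2 **`modelBalancedM_of_isGaloisBalancedAlg`** — FRAME TRANSFER for every slot map `κ : Fin N → Fin (r+1)`: an `Aut(ℂ)`-balanced
  weight of `⨁_j A(κ j)` is a balanced configuration of the census model under `R = realisedPerms e`, with NO Galois hypothesis;
* §3 `weightClassesAlg_le_algebraicClasses_of_isPairPartM` (pair parts have divisor lines).
HONEST FRAMING: nothing about the Hodge conjecture is concluded here; `HC_CM` is not asserted.
[cite: Pohlmann1968, Thm 1] [cite: GaoUllmo2025, Thm 3.1 (3.2)] [cite: Shimura1998, §18.2 Lemma (i)]
[cite: Gordon1999HodgeAVSurvey, 9.2.2] [cite: Milne2020HodgeClassesAV, 1.2 (a) and Thm. 1]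

## References
* [Pohlmann1968] Ann. of Math. 88 (1968), Thm 1.  [GaoUllmo2025] J. Inst. Math. Jussieu 25 (2025), Thm 3.1 (3.2).  [Shimura1998]
  G. Shimura, *Abelian varieties with CM and modular functions*, §18.2 Lemma (i).  [Gordon1999HodgeAVSurvey] CRM Monogr. 10
  (1999), 9.2.2.  [Milne2020HodgeClassesAV] arXiv:2010.08857, 1.2 (a), Thm. 1.
-/

noncomputable section

open CategoryTheory CategoryTheory.Limits NumberField

namespace Summit.HodgeConjecture.CorCM.DecicWeil23Multi

open Literature.AlgebraicGeometry Literature.AlgebraicGeometry.Motives Literature.AlgebraicGeometry.HodgeTheory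
open Literature.AlgebraicGeometry.ComplexMultiplication (IsCMTypeRealisation)
open Literature.AlgebraicGeometry.Pohlmann1968
open Literature.AlgebraicTopology.SingularHomology
open Literature.NumberTheory.ComplexMultiplication
open Summit.HodgeConjecture.CorCM.Census.DecicWeil23Multi (PtM cjM cjM_inl cjM_inr cjM_cjM cjM_ne phiM inl_mem_phiM inr_mem_phiM
  ModelBalancedM IsPairPartM)
open Summit.HodgeConjecture.CorCM.DecicWeil23Pair (realisedPerms mem_realisedPerms apply_comp_eq_of_realises
  comp_eq_tau_iff_of_realises)
open Summit.HodgeConjecture.CorCM.CMWeights (weightClassesAlg_comp_le_algebraicClasses_of_injOn)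
open Summit.HodgeConjecture.CorCM.PairWeights
open Summit.HodgeConjecture.CorCM.DihedralSexticPairCurvePowers (ncard_sep_eq_card_filter)

open scoped Classical Pointwise

/-! ## §0 The slots and the model map -/

section Defs

variable {I : Type}

/-- The fields of the `r + 1` slots of `E × B₁ × ⋯ × B_r`: `(i₀, i₁, …, i₁)` — `Fin.cons`, so that `multiSlots r i₀ i₁ (m+1)` is
definitionally `i₁` and `multiSlots r i₀ i₁ 0` is `i₀`. [folklore] -/
def multiSlots (r : ℕ) (i₀ i₁ : I) : Fin (r + 1) → I := Fin.cons i₀ fun _ : Fin r => i₁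

variable {r : ℕ} {Kf : I → Type} [∀ i, Field (Kf i)] {i₀ i₁ : I}

/-- **The model map** `Hom(k × K × ⋯ × K, ℂ) → PtM r`: `(0, σ) ↦ inl [σ = τ]`, `(m+1, s) ↦ inr (m, e s)`. [folklore] -/
def toPtM (e : (Kf i₁ →+* ℂ) ≃ Fin 5 × Bool) (τ : Kf i₀ →+* ℂ) :
    ((j : Fin (r + 1)) × (Kf (multiSlots r i₀ i₁ j) →+* ℂ)) → PtM r := fun x =>
  Fin.cases (motive := fun j => (Kf (multiSlots r i₀ i₁ j) →+* ℂ) → PtM r)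
    (fun σ => Sum.inl (decide (σ = τ))) (fun m s => Sum.inr (m, e s)) x.1 x.2

/-- `toPtM` on the curve slot. [folklore] -/
@[simp] theorem toPtM_zero (e : (Kf i₁ →+* ℂ) ≃ Fin 5 × Bool) (τ : Kf i₀ →+* ℂ) (σ : Kf i₀ →+* ℂ) :
    toPtM (r := r) e τ ⟨0, σ⟩ = Sum.inl (decide (σ = τ)) := rfl

/-- `toPtM` on the fivefold slots. [folklore] -/
@[simp] theorem toPtM_succ (e : (Kf i₁ →+* ℂ) ≃ Fin 5 × Bool) (τ : Kf i₀ →+* ℂ) (m : Fin r) (s : Kf i₁ →+* ℂ) :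
    toPtM e τ ⟨m.succ, s⟩ = Sum.inr (m, e s) := rfl

/-- Every point of the index set is `(0, σ)` or `(m+1, s)`. [folklore] -/
theorem sigma_casesM (x : (j : Fin (r + 1)) × (Kf (multiSlots r i₀ i₁ j) →+* ℂ)) :
    (∃ σ : Kf i₀ →+* ℂ, x = ⟨0, σ⟩) ∨ ∃ (m : Fin r) (s : Kf i₁ →+* ℂ), x = ⟨m.succ, s⟩ := by
  obtain ⟨j, s⟩ := x
  refine Fin.cases ?_ (fun m => ?_) j s
  · exact fun σ => Or.inl ⟨σ, rfl⟩
  · exact fun s => Or.inr ⟨m, s, rfl⟩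

/-- Complex conjugation on the curve slot of the index set. [folklore] -/
theorem conj_smul_zeroM (σ : Kf i₀ →+* ℂ) :
    (starRingAut : ℂ ≃+* ℂ) • (⟨0, σ⟩ : (j : Fin (r + 1)) × (Kf (multiSlots r i₀ i₁ j) →+* ℂ)) =
      ⟨0, (ComplexEmbedding.conjugate σ : Kf i₀ →+* ℂ)⟩ :=
  Sigma.ext rfl (heq_of_eq (RingHom.ext fun _ => rfl))

/-- Complex conjugation on the fivefold slots of the index set. [folklore] -/
theorem conj_smul_succM (m : Fin r) (s : Kf i₁ →+* ℂ) :
    (starRingAut : ℂ ≃+* ℂ) • (⟨m.succ, s⟩ : (j : Fin (r + 1)) × (Kf (multiSlots r i₀ i₁ j) →+* ℂ)) =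
      ⟨m.succ, (ComplexEmbedding.conjugate s : Kf i₁ →+* ℂ)⟩ :=
  Sigma.ext rfl (heq_of_eq (RingHom.ext fun _ => rfl))

end Defs

/-! ## §1 The model map: injectivity, conjugation; how a realiser of `π` acts -/

section Transfer

variable {I : Type} {r : ℕ} {Kf : I → Type} [∀ i, Field (Kf i)]
  {i₀ i₁ : I} {e : (Kf i₁ →+* ℂ) ≃ Fin 5 × Bool} {τ : Kf i₀ →+* ℂ}
  (hττ : ComplexEmbedding.conjugate τ ≠ τ) (hk : ∀ σ : Kf i₀ →+* ℂ, σ = τ ∨ σ = ComplexEmbedding.conjugate τ)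

include hττ hk in
/-- The model map is injective (`Hom(k, ℂ) = {τ, τ̄}`, `e` a bijection, the slot is recorded). [folklore] -/
theorem toPtM_injective : Function.Injective (toPtM (r := r) (i₀ := i₀) (i₁ := i₁) e τ) := by
  intro x y hxy
  rcases sigma_casesM x with ⟨σ, rfl⟩ | ⟨m, s, rfl⟩ <;> rcases sigma_casesM y with ⟨σ', rfl⟩ | ⟨m', s', rfl⟩
  · rw [toPtM_zero, toPtM_zero, Sum.inl.injEq] at hxy
    rcases hk σ with rfl | rfl <;> rcases hk σ' with rfl | rfl
    · rfl
    · simp only [decide_true] at hxy; exact absurd (of_decide_eq_true hxy.symm) hττ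
    · simp only [decide_true] at hxy; exact absurd (of_decide_eq_true hxy) hττ
    · rfl
  · exact absurd hxy (by rw [toPtM_zero, toPtM_succ]; exact Sum.inl_ne_inr)
  · exact absurd hxy (by rw [toPtM_zero, toPtM_succ]; exact Sum.inr_ne_inl)
  · rw [toPtM_succ, toPtM_succ, Sum.inr.injEq, Prod.mk.injEq] at hxy
    obtain ⟨rfl, h2⟩ := hxy
    rw [e.injective h2]

variable {i : Kf i₀ →+* Kf i₁}
  (he_sign : ∀ s : Kf i₁ →+* ℂ, (e s).2 = true ↔ s.comp i = τ)
  (he_conj : ∀ s : Kf i₁ →+* ℂ, e (ComplexEmbedding.conjugate s) = ((e s).1, !(e s).2))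

include he_conj hττ hk in
/-- Conjugation is read in the model: `toPtM x̄ = cjM (toPtM x)`. [folklore] -/
theorem toPtM_conj_smul (x : (j : Fin (r + 1)) × (Kf (multiSlots r i₀ i₁ j) →+* ℂ)) :
    toPtM e τ ((starRingAut : ℂ ≃+* ℂ) • x) = cjM (toPtM e τ x) := by
  rcases sigma_casesM x with ⟨σ, rfl⟩ | ⟨m, s, rfl⟩
  · have key : decide (ComplexEmbedding.conjugate σ = τ) = !decide (σ = τ) := by
      rcases hk σ with rfl | rfl
      · rw [decide_eq_false hττ]; simp
      · rw [ComplexEmbedding.involutive_conjugate, decide_eq_false hττ]; simp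
    rw [conj_smul_zeroM, toPtM_zero, toPtM_zero, key, cjM_inl]
  · rw [conj_smul_succM, toPtM_succ, toPtM_succ, he_conj, cjM_inr]

variable {P : Fin r → Fin 5 → Bool} {Φ : ∀ j : Fin (r + 1), CMType (Kf (multiSlots r i₀ i₁ j))}
  (hΦ : ∀ (m : Fin r) (s : Kf i₁ →+* ℂ), s ∈ (Φ m.succ).1 ↔ (e s).2 = P m (e s).1)
  (hΨ : ∀ σ : Kf i₀ →+* ℂ, σ ∈ (Φ 0).1 ↔ σ = τ)

include hττ hk he_sign he_conj hΦ hΨ in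
/-- **Membership read in the frame**: for a realiser `ρ` of the permutation `π` of the pairs, `ρ ∘ x ∈ Φ ⟺ toPtM x ∈ phiM P π`
(on the curve slot `ρ` fixes `τ`; on a fivefold slot `ρ` keeps signs and moves the pair `a` to `π a`).
[cite: GaoUllmo2025, Thm 3.1 (3.2)] [cite: Shimura1998, §18.2 Lemma (i)] -/
theorem comp_mem_iff_toPtM_mem_phiM [NumberField (Kf i₁)] [IsCMField (Kf i₁)] {ρ : ℂ ≃+* ℂ} {π : Equiv.Perm (Fin 5)}
    (hρ : ∀ a : Fin 5, (ρ : ℂ →+* ℂ).comp (e.symm (a, true)) = e.symm (π a, true))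
    (x : (j : Fin (r + 1)) × (Kf (multiSlots r i₀ i₁ j) →+* ℂ)) :
    (ρ : ℂ →+* ℂ).comp x.2 ∈ (Φ x.1).1 ↔ toPtM e τ x ∈ phiM P π := by
  rcases sigma_casesM x with ⟨σ, rfl⟩ | ⟨m, s, rfl⟩
  · change (ρ : ℂ →+* ℂ).comp σ ∈ (Φ 0).1 ↔ _
    rw [hΨ, toPtM_zero, inl_mem_phiM, comp_eq_tau_iff_of_realises hττ hk he_sign ρ hρ σ]
    exact ⟨fun h => decide_eq_true h, fun h => of_decide_eq_true h⟩
  · change (ρ : ℂ →+* ℂ).comp s ∈ (Φ m.succ).1 ↔ _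
    rw [hΦ, toPtM_succ, apply_comp_eq_of_realises he_conj ρ hρ s, inr_mem_phiM]

/-! ## §2 Frame transfer for the products of copies, no Galois hypothesis -/

variable {N : ℕ} (κ : Fin N → Fin (r + 1))

include hττ hk he_sign he_conj hΦ hΨ in
/-- **FRAME TRANSFER, no Galois hypothesis**: an `Aut(ℂ)`-balanced weight of `X = ⨁_j A(κ j)` (`IsGaloisBalancedAlg` for the CM
algebra `∏_j K_{κ j}`, types `Φ (κ j)`) is a balanced configuration of the census model under EVERY realised permutation of the
pairs (`R = realisedPerms e`), via `v = toPtM e τ ∘ P`, `P (j, s) = (κ j, s)`. [cite: GaoUllmo2025, Thm 3.1 (3.2)]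
[cite: Pohlmann1968, Thm 1] -/
theorem modelBalancedM_of_isGaloisBalancedAlg [NumberField (Kf i₁)] [IsCMField (Kf i₁)]
    {S : Finset ((j : Fin N) × (Kf (multiSlots r i₀ i₁ (κ j)) →+* ℂ))}
    (hS : IsGaloisBalancedAlg (K := fun j => Kf (multiSlots r i₀ i₁ (κ j))) (fun j => Φ (κ j)) S) :
    ModelBalancedM P (realisedPerms e) (fun x => toPtM e τ ((Sigma.map κ (fun _ => id) :
      ((j : Fin N) × (Kf (multiSlots r i₀ i₁ (κ j)) →+* ℂ)) → ((m : Fin (r + 1)) × (Kf (multiSlots r i₀ i₁ m) →+* ℂ))) x)) S := by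
  intro π hπ
  beta_reduce
  obtain ⟨ρ, hρ⟩ := (mem_realisedPerms e π).1 hπ
  have h := hS ρ
  rw [ncard_sep_eq_card_filter, ncard_sep_eq_card_filter] at h
  have key : ∀ x : (j : Fin N) × (Kf (multiSlots r i₀ i₁ (κ j)) →+* ℂ),
      (ρ : ℂ →+* ℂ).comp x.2 ∈ (Φ (κ x.1)).1 ↔ toPtM e τ ((Sigma.map κ (fun _ => id) :
        ((j : Fin N) × (Kf (multiSlots r i₀ i₁ (κ j)) →+* ℂ)) → ((m : Fin (r + 1)) × (Kf (multiSlots r i₀ i₁ m) →+* ℂ))) x)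
          ∈ phiM P π :=
    fun x => comp_mem_iff_toPtM_mem_phiM hττ hk he_sign he_conj hΦ hΨ hρ ⟨κ x.1, x.2⟩
  rw [Finset.filter_congr fun x _ => key x, Finset.filter_congr fun x _ => (key x).not] at h
  have htot := Finset.card_filter_add_card_filter_not
    (s := S) (fun x => toPtM e τ ((Sigma.map κ (fun _ => id) :
        ((j : Fin N) × (Kf (multiSlots r i₀ i₁ (κ j)) →+* ℂ)) → ((m : Fin (r + 1)) × (Kf (multiSlots r i₀ i₁ m) →+* ℂ))) x)
          ∈ phiM P π)
  omega

end Transfer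

/-! ## §3 Conjugate pairs have algebraic (divisor) lines -/

section Pairs

variable {I : Type} {r : ℕ} {Kf : I → Type} [∀ i, Field (Kf i)] [∀ i, NumberField (Kf i)] [∀ i, IsCMField (Kf i)]
  {i₀ i₁ : I} {N : ℕ} (κ : Fin N → Fin (r + 1)) {e : (Kf i₁ →+* ℂ) ≃ Fin 5 × Bool} {τ : Kf i₀ →+* ℂ}
  (hττ : ComplexEmbedding.conjugate τ ≠ τ) (hk : ∀ σ : Kf i₀ →+* ℂ, σ = τ ∨ σ = ComplexEmbedding.conjugate τ)
  (he_conj : ∀ s : Kf i₁ →+* ℂ, e (ComplexEmbedding.conjugate s) = ((e s).1, !(e s).2))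
  {A : Fin (r + 1) → AbelianVariety ℂ} {Φ : ∀ j : Fin (r + 1), CMType (Kf (multiSlots r i₀ i₁ j))}
  {ι : ∀ j, 𝓞 (Kf (multiSlots r i₀ i₁ j)) →+* End (A j)}
  {θ : ∀ j, Kf (multiSlots r i₀ i₁ j) →+* Module.End ℂ (complexBetti (A j).X 1)}
  (hA : ∀ j, IsCMTypeRealisation (Φ j) (A j) (ι j) (θ j))

include hττ hk he_conj hA in
/-- **A weight of `Y = ⨁ A` whose model image is a conjugate pair `{y, cjM y}` is conjugation-stable, so its line is algebraic** (a
divisor line: Lefschetz `(1,1)` on the abelian variety `⨁ A`). [cite: Gordon1999HodgeAVSurvey, 9.2.2] -/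
theorem weightClassesAlg_le_algebraicClasses_of_image_eq_pairM
    {T : Finset ((j : Fin (r + 1)) × (Kf (multiSlots r i₀ i₁ j) →+* ℂ))} {y : PtM r} (hT : T.image (toPtM e τ) = {y, cjM y}) :
    T.card = 2 ∧ weightClassesAlg A ι (2 * 1) T ≤ algebraicClasses (⨁ A).X 1 := by
  have hinj := toPtM_injective (r := r) (e := e) hττ hk (i₁ := i₁)
  have hcard : T.card = 2 := by
    rw [← Finset.card_image_of_injective T hinj, hT]
    exact Finset.card_pair (cjM_ne y).symm
  refine ⟨hcard, weightClassesAlg_le_algebraicClasses_of_conj_smul_mem hA (m := 1) hcard fun x hx => ?_⟩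
  have hx' : toPtM e τ x ∈ ({y, cjM y} : Finset (PtM r)) := hT ▸ Finset.mem_image_of_mem _ hx
  have hcx : toPtM e τ ((starRingAut : ℂ ≃+* ℂ) • x) ∈ T.image (toPtM e τ) := by
    rw [toPtM_conj_smul hττ hk he_conj x, hT, Finset.mem_insert, Finset.mem_singleton] at *
    rcases hx' with h | h
    · exact Or.inr (by rw [h])
    · exact Or.inl (by rw [h, cjM_cjM])
  exact (hinj.mem_finset_image).1 hcx

include hττ hk he_conj hA in
/-- **A pair part of a weight of `X = ⨁_j A(κ j)` has an algebraic (divisor) line**: the model map is injective on it with image a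
conjugate pair, so its slot projection to `Y = ⨁ A` is a weight with the same image — a divisor line — lifted along `κ`
(distribution lemma). [cite: Gordon1999HodgeAVSurvey, 9.2.2] [cite: Milne2020HodgeClassesAV, 1.2 (a) and Thm. 1] -/
theorem weightClassesAlg_le_algebraicClasses_of_isPairPartM
    {G : Finset ((j : Fin N) × (Kf (multiSlots r i₀ i₁ (κ j)) →+* ℂ))}
    (hG : IsPairPartM (fun x => toPtM e τ ((Sigma.map κ (fun _ => id) :
      ((j : Fin N) × (Kf (multiSlots r i₀ i₁ (κ j)) →+* ℂ)) → ((m : Fin (r + 1)) × (Kf (multiSlots r i₀ i₁ m) →+* ℂ))) x)) G) :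
    G.card = 2 * 1 ∧ weightClassesAlg (fun j => A (κ j)) (fun j => ι (κ j)) (2 * 1) G ≤
      algebraicClasses (⨁ fun j => A (κ j)).X 1 := by
  obtain ⟨y, hcard, hinj, himg⟩ := hG
  set Pm : ((j : Fin N) × (Kf (multiSlots r i₀ i₁ (κ j)) →+* ℂ)) → ((m : Fin (r + 1)) × (Kf (multiSlots r i₀ i₁ m) →+* ℂ)) :=
    Sigma.map κ (fun _ => id) with hPm
  have hPinj : Set.InjOn Pm ↑G := fun x hx x' hx' h => hinj hx hx' (by change toPtM e τ (Pm x) = toPtM e τ (Pm x'); rw [h])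
  set TY : Finset ((m : Fin (r + 1)) × (Kf (multiSlots r i₀ i₁ m) →+* ℂ)) := G.image Pm with hTY
  have hTYimg : TY.image (toPtM e τ) = {y, cjM y} := by rw [hTY, Finset.image_image]; exact himg
  obtain ⟨-, hYalg⟩ := weightClassesAlg_le_algebraicClasses_of_image_eq_pairM hττ hk he_conj hA hTYimg
  have hq : G.card = 2 * 1 := by rw [hcard]
  exact ⟨hq, weightClassesAlg_comp_le_algebraicClasses_of_injOn (K := fun m => Kf (multiSlots r i₀ i₁ m)) hA κ hq hPinj hYalg⟩

end Pairs

end Summit.HodgeConjecture.CorCM.DecicWeil23Multi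

end
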